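import Summits.QuantumFields.YangMills.Theorems.LuscherReductionTwistedTraceScalingBOAssemblyPrelim
import HarnessLib

/-!
# The Born–Oppenheimer KERNEL: `T(boFun φ Ω) = ∫∫ φ(u)·𝒦_β(u,u')·φ(u')` with `𝒦_β(u,u') = ∫∫ Ω(v) K̃_β(orthoTube u v, orthoTube u' v') Ω(v') dπ dπ'`
# (lane A of S-BASE, crux `TwistedTraceScaling` stmt-QuantumFields-20203, C4 INNER; design note `pub/ym-fleet/ym-luscher-20007-p1/COARSE-DESIGN.md` §24.4 (F))

The object the owed Laplace brick (B-T) (`RecordBOInput.hT`) is about: the exact two-variable ONE-SITE kernel `boKernel β Ω` of the tube form on BO functions, via the exact one-site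
disintegration (`integral_boFun_mul_eq`, p646539) twice and one Fubini swap (joint measurability of the gauge-averaged kernel, `measurable_avgKernel`).
(B-T) ⟺ the quadratic form of `boKernel β Ω` on gauge-invariant amplitudes `φ̄ ⊆ 𝒰` equals `σγ·⟨φ̄, K_{L³β} φ̄⟩₁` to relative `κ` (by cdisprove R32 only after colour averaging).
* `measurable_avgKernel` — `(U,V) ↦ K̃_β(U,V)` is jointly measurable;
* `boKernel`, `transferApply_boFun_eq` (`∫ K̃(U,V) boFun(V) dV = ∫ φ(u')·(∫ K̃(U, orthoTube u' v') Ω(v') dπ') du'`);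
* ★★ `tubeForm_boFun_eq` — `tubeForm β (boFun φ Ω) = ∫ u, φ u · ∫ u', boKernel β Ω u u' · φ u'`.
HONEST FRAMING: bookkeeping toward (B-T) for a stub of a child of the CONDITIONAL reduction route R2b1; (B-T) OPEN; C4 OPEN; not a gap, not Clay.
-/

set_option autoImplicit false

noncomputable section

open MeasureTheory Filter Topology Real
open scoped BigOperators
open Literature.MathematicalPhysics.QuantumFieldTheory
open Literature.MathematicalPhysics.QuantumLattice

namespace Summit.QuantumFields.YangMills.Theorems.FemtoTransferGap.TwoLattice.ConstTube

open Summit.QuantumFields.YangMills.Theorems.FemtoTransferGap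
open Summit.QuantumFields.YangMills.Theorems.FemtoTransferGap.TwoLattice.Avg
open Summit.QuantumFields.YangMills.Theorems.FemtoTransferGap.TwoLattice.Stiff (LinkSpace)

variable {L : ℕ} [NeZero L]

/-! ## §1 Joint measurability of the averaged kernel -/

/-- `(U, V, g) ↦ K_β(U, V^g)` is jointly measurable. [folklore] -/
theorem measurable_transferKernel_gaugeAction (β : ℝ) :
    Measurable fun q : (GaugeConfig 3 L SU2 × GaugeConfig 3 L SU2) × (Site 3 L → SU2) => transferKernel su2Rep β q.1.1 (gaugeTransform q.2 q.1.2) := by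
  haveI := secondCountableTopology_su2
  have hK : Measurable fun p : GaugeConfig 3 L SU2 × GaugeConfig 3 L SU2 => transferKernel su2Rep β p.1 p.2 :=
    (continuous_transferKernel su2Rep continuous_su2Rep β).measurable
  have hg : Measurable fun q : (GaugeConfig 3 L SU2 × GaugeConfig 3 L SU2) × (Site 3 L → SU2) => gaugeTransform q.2 q.1.2 := by
    refine measurable_pi_lambda _ fun e => ?_
    simp only [gaugeTransform]
    exact ((((measurable_pi_apply e.1).comp measurable_snd).mul ((measurable_pi_apply e).comp (measurable_snd.comp measurable_fst))).mul
      ((measurable_pi_apply (e.1.shift e.2)).comp measurable_snd).inv)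
  have hm : Measurable fun q : (GaugeConfig 3 L SU2 × GaugeConfig 3 L SU2) × (Site 3 L → SU2) => (q.1.1, gaugeTransform q.2 q.1.2) :=
    (measurable_fst.comp measurable_fst).prodMk hg
  have h := hK.comp hm
  simpa only [Function.comp_def] using h

/-- `(U, V) ↦ K̃_β(U, V)` is jointly measurable. [folklore] -/
theorem measurable_avgKernel (β : ℝ) : Measurable fun p : GaugeConfig 3 L SU2 × GaugeConfig 3 L SU2 => avgKernel β p.1 p.2 := by
  have h2 := ((measurable_transferKernel_gaugeAction (L := L) β).stronglyMeasurable.integral_prod_right' (ν := gaugeMeasure L)).measurable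
  unfold avgKernel
  simpa only using h2

variable (L) in
/-- **The Born–Oppenheimer kernel** `𝒦_β(u,u') = ∫∫ Ω(v)·K̃_β(orthoTube u v, orthoTube u' v')·Ω(v') dπ(v) dπ(v')`. [cite: Luscher1983, §3] -/
def boKernel (β : ℝ) (Ω : LinkSpace L → ℝ) (u u' : GaugeConfig 3 1 SU2) : ℝ :=
  ∫ v, Ω (linkEmbed L v) * (∫ v', avgKernel β (orthoTube L u v) (orthoTube L u' v') * Ω (linkEmbed L v') ∂orthoTransverse L) ∂orthoTransverse L

/-! ## §2 The transfer of a BO function -/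

/-- `∫ K̃(U,V)·boFun φ Ω(V) dV = ∫ φ(u')·(∫ K̃(U, orthoTube u' v')·Ω(v') dπ(v')) du'`. [folklore] -/
theorem transferApply_boFun_eq (β : ℝ) {φ : GaugeConfig 3 1 SU2 → ℝ} (hφ : Measurable φ) {Cφ : ℝ} (hCφ : ∀ u, |φ u| ≤ Cφ) {Ω : LinkSpace L → ℝ}
    (hΩ : Measurable Ω) {CΩ : ℝ} (hCΩ : ∀ x, |Ω x| ≤ CΩ) (U : GaugeConfig 3 L SU2) :
    ∫ V, avgKernel β U V * boFun L φ Ω V ∂configMeasure SU2 L =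
      ∫ u', φ u' * (∫ v', avgKernel β U (orthoTube L u' v') * Ω (linkEmbed L v') ∂orthoTransverse L) ∂configMeasure SU2 1 := by
  obtain ⟨M, hM0, hM⟩ := exists_avgKernel_le (L := L) β
  have hK : ∀ V, |avgKernel β U V| ≤ M := fun V => by rw [abs_of_pos (avgKernel_pos β U V)]; exact hM U V
  have h := integral_boFun_mul_eq hφ hCφ hΩ hCΩ (measurable_avgKernel_right β U) hK (w := fun _ => (1 : ℝ)) measurable_const (Cw := 1)
    (fun _ => by rw [abs_one])
  have e1 : (fun V => avgKernel β U V * boFun L φ Ω V) = fun V => boFun L φ Ω V * avgKernel β U V * (fun _ : GaugeConfig 3 L SU2 => (1 : ℝ)) V := by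
    funext V; ring
  rw [e1, h]
  refine integral_congr_ae (ae_of_all _ fun u' => ?_)
  dsimp only
  unfold fibreInner
  congr 1
  exact integral_congr_ae (ae_of_all _ fun v' => by dsimp only; ring)

/-! ## §3 ★★ The tube form of a BO function -/

/-- ★★ **`tubeForm β (boFun φ Ω) = ∫ φ(u)·(∫ 𝒦_β(u,u')·φ(u') du') du`** (bounded measurable `φ, Ω`). [cite: Luscher1983, §3] -/
theorem tubeForm_boFun_eq (β : ℝ) {φ : GaugeConfig 3 1 SU2 → ℝ} (hφ : Measurable φ) {Cφ : ℝ} (hCφ : ∀ u, |φ u| ≤ Cφ) {Ω : LinkSpace L → ℝ} (hΩ : Measurable Ω)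
    {CΩ : ℝ} (hCΩ : ∀ x, |Ω x| ≤ CΩ) :
    tubeForm β (boFun L φ Ω) = ∫ u, φ u * (∫ u', boKernel L β Ω u u' * φ u' ∂configMeasure SU2 1) ∂configMeasure SU2 1 := by
  haveI := isFiniteMeasure_orthoTransverse L
  obtain ⟨M, hM0, hM⟩ := exists_avgKernel_le (L := L) β
  have hCφ0 : 0 ≤ Cφ := (abs_nonneg _).trans (hCφ 1)
  have hCΩ0 : 0 ≤ CΩ := (abs_nonneg _).trans (hCΩ 0)
  set P : ℝ := (orthoTransverse L).real Set.univ with hP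
  -- the transfer of the BO function: measurable, bounded
  obtain ⟨hJm, ⟨MJ, hJb⟩, -⟩ := integral_avgKernel_mul_props β (measurable_boFun L hφ hΩ) (abs_boFun_le L hCφ hCΩ)
  -- Step 1: outer disintegration
  rw [← tubeCross_self, tubeCross_eq_integral_mul]
  have h1 := integral_boFun_mul_eq hφ hCφ hΩ hCΩ hJm hJb (w := fun _ => (1 : ℝ)) measurable_const (Cw := 1) (fun _ => by rw [abs_one])
  have e1 : (fun U => boFun L φ Ω U * ∫ V, avgKernel β U V * boFun L φ Ω V ∂configMeasure SU2 L) =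
      fun U => boFun L φ Ω U * (∫ V, avgKernel β U V * boFun L φ Ω V ∂configMeasure SU2 L) * (fun _ : GaugeConfig 3 L SU2 => (1 : ℝ)) U := by
    funext U; simp
  rw [e1, h1]
  refine integral_congr_ae (ae_of_all _ fun u => ?_)
  dsimp only
  congr 1
  -- Step 2: inner disintegration inside the fibre integral, then Fubini (v ↔ u')
  unfold fibreInner
  have e2 : ∀ v, (∫ V, avgKernel β (orthoTube L u v) V * boFun L φ Ω V ∂configMeasure SU2 L) * Ω (linkEmbed L v) * (1 : ℝ) =
      ∫ u', Ω (linkEmbed L v) * (φ u' * ∫ v', avgKernel β (orthoTube L u v) (orthoTube L u' v') * Ω (linkEmbed L v') ∂orthoTransverse L) ∂configMeasure SU2 1 := fun v => by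
    rw [mul_one, transferApply_boFun_eq β hφ hCφ hΩ hCΩ, mul_comm, ← integral_const_mul]
  rw [integral_congr_ae (ae_of_all _ e2)]
  -- Fubini on (v, u')
  have hI3 : Measurable fun q : (Edge 3 L → Fin 3 → ℝ) × GaugeConfig 3 1 SU2 × (Edge 3 L → Fin 3 → ℝ) =>
      avgKernel β (orthoTube L u q.1) (orthoTube L q.2.1 q.2.2) * Ω (linkEmbed L q.2.2) := by
    have hΩ' : Measurable fun q : (Edge 3 L → Fin 3 → ℝ) × GaugeConfig 3 1 SU2 × (Edge 3 L → Fin 3 → ℝ) => Ω (linkEmbed L q.2.2) :=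
      hΩ.comp ((measurable_linkEmbed L).comp (measurable_snd.comp measurable_snd))
    have hpair : Measurable fun q : (Edge 3 L → Fin 3 → ℝ) × GaugeConfig 3 1 SU2 × (Edge 3 L → Fin 3 → ℝ) => (orthoTube L u q.1, orthoTube L q.2.1 q.2.2) := by
      refine Measurable.prodMk ?_ ?_
      · have h1 : Measurable fun q : (Edge 3 L → Fin 3 → ℝ) × GaugeConfig 3 1 SU2 × (Edge 3 L → Fin 3 → ℝ) => q.1 := measurable_fst
        have h := (measurable_orthoTube_right (L := L) u).comp h1
        simpa only [Function.comp_def] using h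
      · have h1 : Measurable fun q : (Edge 3 L → Fin 3 → ℝ) × GaugeConfig 3 1 SU2 × (Edge 3 L → Fin 3 → ℝ) => q.2 := measurable_snd
        have h := (measurable_orthoTube L).comp h1
        simpa only [Function.comp_def] using h
    have hK := (measurable_avgKernel (L := L) β).comp hpair
    have hK' : Measurable fun q : (Edge 3 L → Fin 3 → ℝ) × GaugeConfig 3 1 SU2 × (Edge 3 L → Fin 3 → ℝ) => avgKernel β (orthoTube L u q.1) (orthoTube L q.2.1 q.2.2) := by
      simpa only [Function.comp_def] using hK
    exact hK'.mul hΩ'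
  have hI3' : Measurable fun r : ((Edge 3 L → Fin 3 → ℝ) × GaugeConfig 3 1 SU2) × (Edge 3 L → Fin 3 → ℝ) =>
      avgKernel β (orthoTube L u r.1.1) (orthoTube L r.1.2 r.2) * Ω (linkEmbed L r.2) := by
    have hr : Measurable fun r : ((Edge 3 L → Fin 3 → ℝ) × GaugeConfig 3 1 SU2) × (Edge 3 L → Fin 3 → ℝ) => (r.1.1, (r.1.2, r.2)) :=
      (measurable_fst.comp measurable_fst).prodMk ((measurable_snd.comp measurable_fst).prodMk measurable_snd)
    have h := hI3.comp hr
    simpa only [Function.comp_def] using h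
  have hinner_m : Measurable fun q : (Edge 3 L → Fin 3 → ℝ) × GaugeConfig 3 1 SU2 =>
      ∫ v', avgKernel β (orthoTube L u q.1) (orthoTube L q.2 v') * Ω (linkEmbed L v') ∂orthoTransverse L := by
    have h := (hI3'.stronglyMeasurable.integral_prod_right' (ν := orthoTransverse L)).measurable
    simpa only using h
  have hinner_b : ∀ (v : Edge 3 L → Fin 3 → ℝ) (u' : GaugeConfig 3 1 SU2),
      |∫ v', avgKernel β (orthoTube L u v) (orthoTube L u' v') * Ω (linkEmbed L v') ∂orthoTransverse L| ≤ M * CΩ * P := fun v u' => by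
    calc |∫ v', avgKernel β (orthoTube L u v) (orthoTube L u' v') * Ω (linkEmbed L v') ∂orthoTransverse L|
        ≤ ∫ v', |avgKernel β (orthoTube L u v) (orthoTube L u' v') * Ω (linkEmbed L v')| ∂orthoTransverse L := abs_integral_le_integral_abs
      _ ≤ ∫ _v', M * CΩ ∂orthoTransverse L := by
          refine integral_mono_of_nonneg (ae_of_all _ fun _ => abs_nonneg _) (integrable_const _) (ae_of_all _ fun v' => ?_)
          show |avgKernel β (orthoTube L u v) (orthoTube L u' v') * Ω (linkEmbed L v')| ≤ M * CΩ
          rw [abs_mul, abs_of_pos (avgKernel_pos β _ _)]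
          exact mul_le_mul (hM _ _) (hCΩ _) (abs_nonneg _) hM0.le
      _ = M * CΩ * P := by rw [integral_const, smul_eq_mul, hP]; ring
  have hF : Integrable (fun q : (Edge 3 L → Fin 3 → ℝ) × GaugeConfig 3 1 SU2 =>
      Ω (linkEmbed L q.1) * (φ q.2 * ∫ v', avgKernel β (orthoTube L u q.1) (orthoTube L q.2 v') * Ω (linkEmbed L v') ∂orthoTransverse L))
      ((orthoTransverse L).prod (configMeasure SU2 1)) := by
    refine integrable_of_measurable_abs_le _ ((hΩ.comp ((measurable_linkEmbed L).comp measurable_fst)).mul ((hφ.comp measurable_snd).mul hinner_m))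
      (C := CΩ * (Cφ * (M * CΩ * P))) fun q => ?_
    rw [abs_mul, abs_mul]
    exact mul_le_mul (hCΩ _) (mul_le_mul (hCφ _) (hinner_b _ _) (abs_nonneg _) hCφ0) (by positivity) hCΩ0
  rw [integral_integral_swap hF]
  refine integral_congr_ae (ae_of_all _ fun u' => ?_)
  dsimp only
  unfold boKernel
  rw [← integral_mul_const]
  have e3 : ∀ v, Ω (linkEmbed L v) * (φ u' * ∫ v', avgKernel β (orthoTube L u v) (orthoTube L u' v') * Ω (linkEmbed L v') ∂orthoTransverse L) =
      Ω (linkEmbed L v) * (∫ v', avgKernel β (orthoTube L u v) (orthoTube L u' v') * Ω (linkEmbed L v') ∂orthoTransverse L) * φ u' := fun v => by ring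
  simp_rw [e3]

end Summit.QuantumFields.YangMills.Theorems.FemtoTransferGap.TwoLattice.ConstTube

end
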